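import Literature.AlgebraicGeometry.Frobenioids.Thm36SubPerfectionUnits
import Literature.AlgebraicGeometry.Frobenioids.Thm36SubProofs
import Literature.AlgebraicGeometry.Frobenioids.ArchimedeanCharSplitting
import HarnessLib

/-!
# Frobenioids II, Thm. 3.6 (i) for `C^ℚ := C^pf`: "the canonical decomposition of Definition 3.1 (ii) determines
# a characteristic splitting on `C^Λ`" — PROVED at `Λ = ℚ` for THE perfection of the archimedean Frobenioid

Mochizuki, *The geometry of Frobenioids II: poly-Frobenioids*, Kyushu J. Math. **62** (2008) 401–460, §3,
Thm. 3.6 (i), kurims text p. 36 ll. 34–37 (journal p. 431): "the canonical decomposition of Definition 3.1, (ii),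
determines a characteristic splitting [cf. [Mzk5], Definition 2.3] on `C^Λ`" [cite: MochizukiFrdII2008, Thm 3.6 (i) p.36];
proof p. 38: "it is immediate from the definitions that the canonical decomposition of Definition 3.1, (ii),
determines a characteristic splitting on `C^Λ`".  Here `Λ = ℚ`, i.e. `F = C^ℚ := C^pf` (Ex. 3.3 (ii) p. 28: THE
perfection of `C → F_Φ`, [FrdI] Def. 3.1 (iii), abc-iut-L1-d9's `PreFrobenioid.Perfection hF`, read through the
sub-DAG vocabulary `Thm36Sub.pfCat/pfStr` of abc-iut-w4-d074).

PROOF-ONLY file (abc-iut cell, layer L1, row «M13-c4»; seat abc-iut-w5-d237, gen 4; companion of gen 0's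
`Thm36SubPerfectionUnits(Q).lean`, which computed `O^×((A, n))`).  Statement owner abc-iut-L1-t9's generic
predicate `ArchFrd.Thm36i_charSplitting F radial` (`ArchimedeanStandardType.lean`) — "there is a characteristic
splitting `τ` on `F` ([FrdI] Def. 2.3, abc-iut-L1-t2's `PreFrobenioid.CharacteristicSplitting`) whose submonoids
`τ(A)` are, for isotropic `A`, exactly the endomorphisms satisfying `radial A`" — was instantiated and PROVED at
`Λ = ℤ` by L1-t9 (`thm36i_charSplitting_C`, `ArchimedeanCharSplitting.lean`: `τ(A)` = the radial elements of
`O^▷(A)`, positive real scalar) and typed at `Λ = ℝ` by w4-d074 (`Thm36Sub.charSplitting_R`).  This file closes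
the remaining case `Λ = ℚ`: by [FrdI] Prop. 5.5 (i) / Def. 3.1 (iii), `O^▷((A, n)) = lim_→ O^▷(A^{(c)})` over the
diagonal levels (`PreFrobenioid.Perfection.endClass`, d9's `PerfectionEndomorphisms.lean`), and

  `τ((A, n)) := lim_→ τ(A^{(c)})` = the classes `[θ]` of RADIAL elements `θ ∈ O^▷(A^{(c)})`, `c ≥ 1`,

spelled INLINE in the closing statement (no new definition; the slot-table holder may name it
`Thm36Sub.charSplitting_Q`).  Contents, everything PROVED:
* transport (`scalar_liftLevel_of_mem`, `radialO_liftLevel`): the Prop. 1.10 (i) transport of a radial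
  `θ ∈ O^▷(A^{(c)})` to `A^{(c′)}` is radial with scalar `(scalar θ)^{c′/c}` — the Galois twist of the base of
  `A^{(c)} → A^{(c′)}` dies on positive reals (same computation as gen 0's `scalar_liftUnit` for units);
* `τ((A, n))` is a submonoid of `O^▷((A, n))` (common diagonal level, `endClass_comp`);
* the subfunctor condition along LINEAR arrows `φ : (A, n) → (B, m)` of `C^pf` (`exists_level_square`): a square
  `φ ≫ [θ_β] = [θ_α] ≫ φ` in `C^pf` is represented, at a high enough level, by a square `ψ ≫ θ_β″ = θ_α″ ≫ ψ` of `C`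
  with `ψ` linear (`mk_compAt`, `Hom.mk_eq_mk`, `liftLevel_comp`), so L1-t9's `scalar_eq_of_square` applies;
* Def. 2.3 (a), `τ((A, n)) → O^▷((A, n))/O^×((A, n))` bijective: injective by gen 0's `exists_unit_rep` + L1-t9's
  `radial_eq_of_unit_comp` at a common level; surjective by raising the level of a representative to a naively
  isotropic Frobenius power ([FrdII] Lem. 3.2 (v), gen 0's `exists_isotropic_levels`) and the polar decomposition
  `unit_comp_radial_eq` there;
* Def. 2.3 (b): every object of `C^pf` is isotropic (Thm. 3.6 (i) "`(C^Λ)^istr = C^Λ`", `istrAll_Q_holds`), so an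
  isotropic hull `φ : X → Y` of `C^pf` is an isomorphism and `α := φ ≫ β ≫ φ⁻¹` works.
No definitions; no statement of the paper is strengthened or re-typed (the other `Λ = ℚ` clauses of Thm. 3.6 (i) —
model type / rational function monoid, `(C^ℚ)^un-tr ⥲ C^ℝ` — are NOT touched); nothing here bears on
[IUTchIII] Cor. 3.12 (classical, refereed [FrdI]/[FrdII]); typed ≠ proved except where a `theorem` says so.
-/

noncomputable section

namespace Literature.AlgebraicGeometry.Frobenioids

open CategoryTheory Opposite

universe v u

namespace ArchFrd

namespace Thm36Sub

variable {D : Type u} [Category.{v} D] {π : D ⥤ D0}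
variable {hF : PreFrobenioid.IsFrobenioid (C.toElem π)} (X : pfCat π hF)

open PreFrobenioid PreFrobenioid.Perfection

/-! ### `O^▷` for the structure functor `pfStr` is `O^▷` for d9's operations (bookkeeping) -/

/-- Membership in `O^▷((A, n))` for the structure functor `pfStr` of THE perfection is membership for
abc-iut-L1-d9's operations `Perfection.ops` (definitional). [cite: MochizukiFrdI2008, Prop. 3.2 (i) p.58] -/
theorem mem_endSubmonoid_pfStr_iff (t : End X) :
    t ∈ endSubmonoid (pfStr π hF) X ↔ t ∈ (Perfection.ops hF).endSubmonoid X :=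
  Iff.rfl

/-- `[θ] ∈ O^▷((A, n))` for `θ ∈ O^▷(A^{(c)})` (d9's dictionary `O^▷((A, n)) = lim_→ O^▷(A^{(c)})`, read for
`pfStr`). [cite: MochizukiFrdI2008, Prop. 5.5 (i) p.104] -/
theorem endClass_mem_endSubmonoid (c : ℕ+) (θ : frobPow hF X.obj c ⟶ frobPow hF X.obj c)
    (hθ : θ ∈ endSubmonoid (C.toElem π) (frobPow hF X.obj c)) :
    (endClass X c θ : End X) ∈ endSubmonoid (pfStr π hF) X :=
  (endClassHom_mem_iff X c (End.of θ)).mpr hθ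

/-! ### Transport of radial elements of `O^▷(A^{(c)})` between Frobenius powers -/

/-- **The scalar of the transport of `θ ∈ O^▷(A^{(c)})`** to `A^{(c′)}` (`c ∣ c′`) along the transition
`A^{(c)} → A^{(c′)}` of degree `k = c′/c`: the Galois twist, of the base of the transition, of `(scalar θ)^k`
(composition law of Ex. 3.3 (i); the unit case is gen 0's `scalar_liftUnit`).
[cite: MochizukiFrdII2008, Ex 3.3 (i) p.27] -/
theorem scalar_liftLevel_of_mem {c c' : ℕ+} (h : c ∣ c') (θ : frobPow hF X.obj c ⟶ frobPow hF X.obj c)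
    (hθ : θ ∈ endSubmonoid (C.toElem π) (frobPow hF X.obj c)) :
    C0.scalar (liftLevel hF θ h h rfl).fst =
      D0.galAct (D0.Hom.twists (C0.Base (frobTrans hF X.obj h).fst))
        (C0.scalar θ.fst ^ (C0.degFr (frobTrans hF X.obj h).fst : ℕ)) := by
  have hsq := congrArg (fun f => C0.scalar (CFP.Hom.fst f)) (liftLevel_spec hF θ h h rfl)
  simp only [CFP.comp_fst, C0.scalar_comp'] at hsq
  have hd : C0.degFr (liftLevel hF θ h h rfl).fst = 1 := ((liftLevel_mem_iff X h (End.of θ) rfl).mpr hθ).2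
  rw [act_eq_of_snd π θ hθ.1, hd, PNat.one_coe, pow_one] at hsq
  change D0.galAct (D0.Hom.twists (C0.Base (frobTrans hF X.obj h).fst)) _ * _ = _ at hsq
  rw [mul_comm] at hsq
  have hsq' := mul_left_cancel hsq
  rw [← hsq', D0.galAct_galAct]

/-- **Transport preserves radiality**: the transport to `A^{(c′)}` of a radial `θ ∈ O^▷(A^{(c)})` is radial (a
positive real scalar is raised to a power and is fixed by every Galois twist).
[cite: MochizukiFrdII2008, Thm 3.6 (i) p.36] -/
theorem radialO_liftLevel {c c' : ℕ+} (h : c ∣ c') (θ : frobPow hF X.obj c ⟶ frobPow hF X.obj c)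
    (hθ : radialO π (frobPow hF X.obj c) θ) : radialO π (frobPow hF X.obj c') (liftLevel hF θ h h rfl) := by
  refine ⟨(liftLevel_mem_iff X h (End.of θ) rfl).mpr hθ.1, ?_⟩
  have hs : C0.scalar (liftLevel hF θ h h rfl).fst =
      ofPosReal ℂ (radialScalar π hθ ^ (C0.degFr (frobTrans hF X.obj h).fst : ℕ)) := by
    rw [scalar_liftLevel_of_mem X h θ hθ.1, scalar_eq_ofPosReal π hθ, ← map_pow,
      D0.galAct_eq_self_of_mem_scalars_real _ (ofPosReal_mem_scalars _ D0.real)]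
  change ((C0.scalar (liftLevel hF θ h h rfl).fst : ℂˣ) : ℂ).im = 0 ∧
    0 < ((C0.scalar (liftLevel hF θ h h rfl).fst : ℂˣ) : ℂ).re
  rw [hs, coe_ofPosReal]
  exact ⟨Complex.ofReal_im _,
    lt_of_lt_of_eq (radialScalar π hθ ^ (C0.degFr (frobTrans hF X.obj h).fst : ℕ)).2 (Complex.ofReal_re _).symm⟩

/-- Transport does not change the class (d9's `endClass_liftLevel`, at the proof term used here).
[cite: MochizukiFrdI2008, Def. 3.1 (ii) p.56] -/
theorem endClass_liftLevel' {c c' : ℕ+} (h : c ∣ c') (θ : frobPow hF X.obj c ⟶ frobPow hF X.obj c) :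
    endClass X c' (liftLevel hF θ h h rfl) = endClass X c θ :=
  endClass_liftLevel X h θ rfl

/-! ### `τ((A, n))`: the classes of radial elements — closure under composition -/

/-- The classes of radial elements are closed under composition in `C^pf` (bring two representatives to a
common diagonal level; classes at one level compose in `C`; radial elements form a submonoid there).
[cite: MochizukiFrdII2008, Thm 3.6 (i) p.36] -/
theorem radialClass_comp {t s : X ⟶ X}
    (ht : ∃ (c : ℕ+) (θ : frobPow hF X.obj c ⟶ frobPow hF X.obj c),
      radialO π (frobPow hF X.obj c) θ ∧ endClass X c θ = t)
    (hs : ∃ (c : ℕ+) (θ : frobPow hF X.obj c ⟶ frobPow hF X.obj c),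
      radialO π (frobPow hF X.obj c) θ ∧ endClass X c θ = s) :
    ∃ (c : ℕ+) (θ : frobPow hF X.obj c ⟶ frobPow hF X.obj c),
      radialO π (frobPow hF X.obj c) θ ∧ endClass X c θ = t ≫ s := by
  obtain ⟨c, θ, hθ, rfl⟩ := ht
  obtain ⟨c', θ', hθ', rfl⟩ := hs
  refine ⟨c * c', liftLevel hF θ (dvd_mul_right c c') (dvd_mul_right c c') rfl ≫
      liftLevel hF θ' (dvd_mul_left c' c) (dvd_mul_left c' c) rfl, ?_, ?_⟩
  · exact (radialSubmonoid π (frobPow hF X.obj (c * c'))).mul_mem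
      (radialO_liftLevel X (dvd_mul_left c' c) θ' hθ') (radialO_liftLevel X (dvd_mul_right c c') θ hθ)
  · rw [← endClass_comp, endClass_liftLevel' X, endClass_liftLevel' X]

/-! ### Squares in `C^pf` are squares of representatives at a high enough level -/

/-- Composite, in `C^pf`, of a representative `ψ : A^{(a)} → B^{(b)}` with the class of an endomorphism of
`B^{(b)}` (computed at the triple level `(a, b, b)`). [cite: MochizukiFrdI2008, Def. 3.1 (iii) p.57] -/
theorem mk_comp_endClass {Y : pfCat π hF} (L : Level X Y) (ψ : L.HomAt)
    (θ : frobPow hF Y.obj L.b ⟶ frobPow hF Y.obj L.b) :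
    (Hom.mk ⟨L, ψ⟩ : X ⟶ Y) ≫ endClass Y L.b θ = Hom.mk ⟨L, ψ ≫ θ⟩ := by
  let T : Level₃ X Y Y := ⟨L.a, L.b, L.b, L.eq, rfl⟩
  have e := mk_compAt T ⟨L, ψ⟩ ⟨Level.diag Y L.b, θ⟩ ⟨dvd_rfl, dvd_rfl⟩ ⟨dvd_rfl, dvd_rfl⟩
  rw [endClass_def, mk_comp_mk, ← e]
  show Hom.mk ⟨L, liftLevel hF ψ dvd_rfl dvd_rfl _ ≫ liftLevel hF θ dvd_rfl dvd_rfl _⟩ = _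
  rw [liftLevel_rfl, liftLevel_rfl]

/-- Composite, in `C^pf`, of the class of an endomorphism of `A^{(a)}` with a representative
`ψ : A^{(a)} → B^{(b)}` (computed at the triple level `(a, a, b)`). [cite: MochizukiFrdI2008, Def. 3.1 (iii) p.57] -/
theorem endClass_comp_mk {Y : pfCat π hF} (L : Level X Y) (ψ : L.HomAt)
    (θ : frobPow hF X.obj L.a ⟶ frobPow hF X.obj L.a) :
    endClass X L.a θ ≫ (Hom.mk ⟨L, ψ⟩ : X ⟶ Y) = Hom.mk ⟨L, θ ≫ ψ⟩ := by
  let T : Level₃ X X Y := ⟨L.a, L.a, L.b, rfl, L.eq⟩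
  have e := mk_compAt T ⟨Level.diag X L.a, θ⟩ ⟨L, ψ⟩ ⟨dvd_rfl, dvd_rfl⟩ ⟨dvd_rfl, dvd_rfl⟩
  rw [endClass_def, mk_comp_mk, ← e]
  show Hom.mk ⟨L, liftLevel hF θ dvd_rfl dvd_rfl _ ≫ liftLevel hF ψ dvd_rfl dvd_rfl _⟩ = _
  rw [liftLevel_rfl, liftLevel_rfl]

/-- A representative may be moved to the scaled level `(a·k, b·k)` without changing its class.
[cite: MochizukiFrdI2008, Def. 3.1 (ii) p.56] -/
theorem mk_eq_mk_scaled {Y : pfCat π hF} (L : Level X Y) (ψ : L.HomAt) (k : ℕ+) :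
    (Hom.mk ⟨L, ψ⟩ : X ⟶ Y) =
      Hom.mk ⟨⟨L.a * k, L.b * k, by rw [← mul_assoc, L.eq, mul_assoc]⟩,
        liftLevel hF ψ (dvd_mul_right L.a k) (dvd_mul_right L.b k)
          (Level.degFr_eq L ⟨L.a * k, L.b * k, by rw [← mul_assoc, L.eq, mul_assoc]⟩
            ⟨dvd_mul_right L.a k, dvd_mul_right L.b k⟩)⟩ :=
  (Hom.mk_lift ⟨L, ψ⟩ ⟨L.a * k, L.b * k, by rw [← mul_assoc, L.eq, mul_assoc]⟩
    ⟨dvd_mul_right L.a k, dvd_mul_right L.b k⟩).symm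

/-- **Squares descend to representatives.** If `φ ≫ [θ_β] = [θ_α] ≫ φ` in `C^pf` for `φ : (A, n) → (B, m)`,
`θ_β` a radial element of `O^▷(B^{(c)})` and `θ_α ∈ O^▷(A^{(c′)})`, then at some level `(a, b)` there are a
representative `ψ : A^{(a)} → B^{(b)}` of `φ`, a radial `θ_β″ ∈ O^▷(B^{(b)})` and a `θ_α″ ∈ O^▷(A^{(a)})` with
`[θ_α″] = [θ_α]` forming a square `ψ ≫ θ_β″ = θ_α″ ≫ ψ` of `C` (directedness of the levels + the inductive-limit
criterion). [cite: MochizukiFrdI2008, Def. 3.1 (iii) p.57] -/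
theorem exists_level_square {Y : pfCat π hF} (φ : X ⟶ Y) {c c' : ℕ+}
    (θβ : frobPow hF Y.obj c ⟶ frobPow hF Y.obj c) (hθβ : radialO π (frobPow hF Y.obj c) θβ)
    (θα : frobPow hF X.obj c' ⟶ frobPow hF X.obj c')
    (hθα : θα ∈ endSubmonoid (C.toElem π) (frobPow hF X.obj c'))
    (h : φ ≫ endClass Y c θβ = endClass X c' θα ≫ φ) :
    ∃ (a b : ℕ+) (hab : X.idx * a = Y.idx * b) (ψ : frobPow hF X.obj a ⟶ frobPow hF Y.obj b)
      (θβ' : frobPow hF Y.obj b ⟶ frobPow hF Y.obj b) (θα' : frobPow hF X.obj a ⟶ frobPow hF X.obj a),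
      (Hom.mk ⟨⟨a, b, hab⟩, ψ⟩ : X ⟶ Y) = φ ∧ radialO π (frobPow hF Y.obj b) θβ' ∧
        θα' ∈ endSubmonoid (C.toElem π) (frobPow hF X.obj a) ∧ endClass X a θα' = endClass X c' θα ∧
          ψ ≫ θβ' = θα' ≫ ψ := by
  obtain ⟨⟨L, ψ₀⟩, rfl⟩ := Hom.mk_surjective φ
  -- move everything to the scaled level `(a₁, b₁) = (a₀·c·c′, b₀·c·c′)`
  let k : ℕ+ := c * c'
  let L₁ : Level X Y := ⟨L.a * k, L.b * k, by rw [← mul_assoc, L.eq, mul_assoc]⟩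
  have hL : L.LE L₁ := ⟨dvd_mul_right L.a k, dvd_mul_right L.b k⟩
  let ψ₁ : L₁.HomAt := liftLevel hF ψ₀ hL.1 hL.2 (Level.degFr_eq L L₁ hL)
  have hψ₁ : (Hom.mk ⟨L₁, ψ₁⟩ : X ⟶ Y) = Hom.mk ⟨L, ψ₀⟩ := (mk_eq_mk_scaled X L ψ₀ k).symm
  have hca : c' ∣ L₁.a := (dvd_mul_left c' c).trans (dvd_mul_left k L.a)
  have hcb : c ∣ L₁.b := (dvd_mul_right c c').trans (dvd_mul_left k L.b)
  let θα₁ := liftLevel hF θα hca hca rfl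
  let θβ₁ := liftLevel hF θβ hcb hcb rfl
  have hα₁ : endClass X L₁.a θα₁ = endClass X c' θα := endClass_liftLevel' X hca θα
  have hβ₁ : endClass Y L₁.b θβ₁ = endClass Y c θβ := endClass_liftLevel' Y hcb θβ
  -- the two composites, computed at the level `(a₁, b₁)`
  have h₁ : (Hom.mk ⟨L₁, ψ₁ ≫ θβ₁⟩ : X ⟶ Y) = Hom.mk ⟨L₁, θα₁ ≫ ψ₁⟩ := by
    rw [← mk_comp_endClass X L₁ ψ₁ θβ₁, ← endClass_comp_mk X L₁ ψ₁ θα₁, hα₁, hβ₁, hψ₁]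
    exact h
  -- agreement at a common higher level `M = (a, b)`
  obtain ⟨M, hr, hs, e⟩ := Hom.mk_eq_mk.mp h₁
  change liftLevel hF (ψ₁ ≫ θβ₁) hr.1 hr.2 (Level.degFr_eq L₁ M hr) =
    liftLevel hF (θα₁ ≫ ψ₁) hs.1 hs.2 (Level.degFr_eq L₁ M hs) at e
  rw [liftLevel_comp hF ψ₁ θβ₁ hr.1 hr.2 hr.2 (Level.degFr_eq L₁ M hr) rfl,
    liftLevel_comp hF θα₁ ψ₁ hs.1 hs.1 hs.2 rfl (Level.degFr_eq L₁ M hs)] at e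
  have eψ : liftLevel hF ψ₁ hs.1 hs.2 (Level.degFr_eq L₁ M hs) =
      liftLevel hF ψ₁ hr.1 hr.2 (Level.degFr_eq L₁ M hr) := rfl
  rw [eψ] at e
  refine ⟨M.a, M.b, M.eq, liftLevel hF ψ₁ hr.1 hr.2 (Level.degFr_eq L₁ M hr),
    liftLevel hF θβ₁ hr.2 hr.2 rfl, liftLevel hF θα₁ hs.1 hs.1 rfl, ?_,
    radialO_liftLevel Y hr.2 θβ₁ (radialO_liftLevel Y hcb θβ hθβ),
    (liftLevel_mem_iff X hs.1 (End.of θα₁) rfl).mpr ((liftLevel_mem_iff X hca (End.of θα) rfl).mpr hθα),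
    (endClass_liftLevel' X hs.1 θα₁).trans hα₁, e⟩
  rw [← hψ₁]
  exact Hom.mk_lift ⟨L₁, ψ₁⟩ M hr

/-! ### Def. 2.3 (a), injectivity: radial classes that differ by a unit coincide -/

/-- Radial classes `t₁, t₂ ∈ τ((A, n))` with `γ ≫ t₁ = t₂` for some `γ ∈ O^×((A, n))` are EQUAL: `γ` is the class
of a unit of some `A^{(c)}` (gen 0's `exists_unit_rep`), the three representatives meet at a common level where,
by the inductive-limit criterion, `θ_γ″ ≫ θ₁″ = θ₂″` in `C`, and L1-t9's `radial_eq_of_unit_comp` applies.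
[cite: MochizukiFrdII2008, Thm 3.6 (i) p.36] -/
theorem radialClass_eq_of_unit_comp {t₁ t₂ : X ⟶ X}
    (ht₁ : ∃ (c : ℕ+) (θ : frobPow hF X.obj c ⟶ frobPow hF X.obj c),
      radialO π (frobPow hF X.obj c) θ ∧ endClass X c θ = t₁)
    (ht₂ : ∃ (c : ℕ+) (θ : frobPow hF X.obj c ⟶ frobPow hF X.obj c),
      radialO π (frobPow hF X.obj c) θ ∧ endClass X c θ = t₂)
    (γ : Aut X) (hγ : γ ∈ unitsSubgroup (pfStr π hF) X) (h : γ.hom ≫ t₁ = t₂) : t₁ = t₂ := by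
  obtain ⟨c₁, θ₁, hθ₁, rfl⟩ := ht₁
  obtain ⟨c₂, θ₂, hθ₂, rfl⟩ := ht₂
  obtain ⟨c₃, θ₃, hθ₃, e₃⟩ := exists_unit_rep X γ hγ
  -- common level `d = c₁ c₂ c₃`
  have h₁ : c₁ ∣ c₁ * c₂ * c₃ := Dvd.intro (c₂ * c₃) (mul_assoc _ _ _).symm
  have h₂ : c₂ ∣ c₁ * c₂ * c₃ :=
    Dvd.intro (c₁ * c₃) (show c₂ * (c₁ * c₃) = c₁ * c₂ * c₃ by rw [mul_left_comm, mul_assoc])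
  have h₃ : c₃ ∣ c₁ * c₂ * c₃ := Dvd.intro (c₁ * c₂) (mul_comm _ _)
  have hcomp : endClass X (c₁ * c₂ * c₃) (liftLevel hF θ₃.hom h₃ h₃ rfl ≫ liftLevel hF θ₁ h₁ h₁ rfl) =
      endClass X (c₁ * c₂ * c₃) (liftLevel hF θ₂ h₂ h₂ rfl) := by
    rw [← endClass_comp, endClass_liftLevel' X, endClass_liftLevel' X, endClass_liftLevel' X, e₃]
    exact h
  obtain ⟨d, hd, hd', e⟩ := (endClass_eq_iff X _ _).mp hcomp
  rw [liftLevel_comp hF _ _ hd hd hd rfl rfl] at e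
  -- at level `d`: `θ₃″ ≫ θ₁″ = θ₂″` with `θ₃″` a unit and `θ₁″`, `θ₂″` radial
  have hθ₁'' := radialO_liftLevel X hd _ (radialO_liftLevel X h₁ θ₁ hθ₁)
  have hθ₂'' := radialO_liftLevel X hd' _ (radialO_liftLevel X h₂ θ₂ hθ₂)
  have hu₃' : liftUnit X h₃ θ₃ ∈ unitsSubgroup (C.toElem π) (frobPow hF X.obj (c₁ * c₂ * c₃)) :=
    liftUnit_mem X h₃ θ₃ hθ₃
  have hu₃'' : liftUnit X hd (liftUnit X h₃ θ₃) ∈ unitsSubgroup (C.toElem π) (frobPow hF X.obj d) :=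
    liftUnit_mem X hd _ hu₃'
  have e' : (liftUnit X hd (liftUnit X h₃ θ₃)).hom ≫ liftLevel hF (liftLevel hF θ₁ h₁ h₁ rfl) hd hd rfl =
      liftLevel hF (liftLevel hF θ₂ h₂ h₂ rfl) hd' hd' rfl := e
  have heq := radial_eq_of_unit_comp π hθ₁'' hθ₂'' _ hu₃'' e'
  rw [← endClass_liftLevel' X h₁ θ₁, ← endClass_liftLevel' X hd, heq, endClass_liftLevel' X,
    endClass_liftLevel' X]

/-! ### Def. 2.3 (a), surjectivity: every element of `O^▷((A, n))` is a unit times a radial class -/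

/-- **Polar decomposition in `O^▷((A, n))`**: every `e ∈ O^▷((A, n))` is `γ ≫ t` with `γ ∈ O^×((A, n))` and `t` a
radial class — represent `e` by `θ ∈ O^▷(A^{(c)})`, raise `c` to a level where `A^{(c)}` is naively isotropic
([FrdII] Lem. 3.2 (v), gen 0's `exists_isotropic_levels`) and use the polar decomposition `θ′ = γ₀ ≫ ρ` there
(L1-t9's `unit_comp_radial_eq`). [cite: MochizukiFrdII2008, Thm 3.6 (i) p.36] -/
theorem exists_unit_comp_radialClass (e : X ⟶ X) (he : (e : End X) ∈ endSubmonoid (pfStr π hF) X) :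
    ∃ (t : X ⟶ X), (∃ (c : ℕ+) (θ : frobPow hF X.obj c ⟶ frobPow hF X.obj c),
      radialO π (frobPow hF X.obj c) θ ∧ endClass X c θ = t) ∧
      ∃ γ : Aut X, γ ∈ unitsSubgroup (pfStr π hF) X ∧ γ.hom ≫ t = e := by
  obtain ⟨c, θ, hθ, hθe⟩ := exists_endClassHom_eq_of_mem X ((mem_endSubmonoid_pfStr_iff X e).mp he)
  obtain ⟨n₀, hn₀⟩ := exists_isotropic_levels X
  have hcd : c ∣ c * n₀ := dvd_mul_right c n₀
  have hiso : (frobPow hF X.obj (c * n₀)).fst.IsNaivelyIsotropic := hn₀ _ (dvd_mul_left n₀ c)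
  have hθ' : liftLevel hF (End.asHom θ) hcd hcd rfl ∈ endSubmonoid (C.toElem π) (frobPow hF X.obj (c * n₀)) :=
    (liftLevel_mem_iff X hcd θ rfl).mpr hθ
  have hpol := unit_comp_radial_eq π hiso (liftLevel hF (End.asHom θ) hcd hcd rfl) hθ'.1 hθ'.2
  have hw : (unitPart ℂ (C0.scalar (liftLevel hF (End.asHom θ) hcd hcd rfl).fst) : ℂˣ) ∈
      D0.scalars (frobPow hF X.obj (c * n₀)).fst.base :=
    unitPart_coe_mem_scalars (C0.Hom.scalar_mem (liftLevel hF (End.asHom θ) hcd hcd rfl).fst)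
  have hn : ‖((unitPart ℂ (C0.scalar (liftLevel hF (End.asHom θ) hcd hcd rfl).fst) : ℂˣ) : ℂ)‖ = 1 :=
    (mem_normOneSubgroup_iff ℂ _).1 (unitPart ℂ (C0.scalar (liftLevel hF (End.asHom θ) hcd hcd rfl).fst)).2
  have hγ₀ := unitAutC_mem π (frobPow hF X.obj (c * n₀)) hiso _ hw hn
  refine ⟨endClass X (c * n₀) (radialEndC π (frobPow hF X.obj (c * n₀))
      (absHom ℂ (C0.scalar (liftLevel hF (End.asHom θ) hcd hcd rfl).fst))
      (absHom_scalar_le_one π (liftLevel hF (End.asHom θ) hcd hcd rfl) hθ'.2)),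
    ⟨c * n₀, _, radialEndC_mem π _ _ _, rfl⟩,
    classAut X (c * n₀) (unitAutC π (frobPow hF X.obj (c * n₀)) hiso _ hw hn),
    classAut_mem X (c * n₀) _ hγ₀, ?_⟩
  change endClass X (c * n₀) (unitAutC π (frobPow hF X.obj (c * n₀)) hiso _ hw hn).hom ≫
    endClass X (c * n₀) _ = e
  rw [endClass_comp, hpol, endClass_liftLevel' X hcd]
  exact hθe

/-! ### Def. 2.3 (b): isotropic hulls in `C^pf` are isomorphisms -/

/-- Every object of `C^pf` is isotropic (Thm. 3.6 (i), "`(C^Λ)^istr = C^Λ` for `Λ ≥ ℚ`", w4-d074/L1-lineage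
`istrAll_Q_holds`), so for an isotropic hull `φ : X → Y` of `C^pf` and any `β ∈ O^▷(Y)` the endomorphism
`α := φ ≫ β ≫ φ⁻¹` lies in `O^▷(X)` and `φ ≫ β = α ≫ φ` (`φ` is an isomorphism by its universal property at `𝟙_X`).
[cite: MochizukiFrdI2008, Def. 2.3 p.47] -/
theorem exists_conj_of_isIsotropicHull {Y : pfCat π hF} (φ : X ⟶ Y)
    (hφ : IsIsotropicHull (pfStr π hF) φ) (β : Y ⟶ Y) (hβ : (β : End Y) ∈ endSubmonoid (pfStr π hF) Y) :
    ∃ α ∈ endSubmonoid (pfStr π hF) X, φ ≫ β = α ≫ φ := by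
  have hX : IsIsotropic (pfStr π hF) X := istrAll_Q_holds π hF (by decide) X
  obtain ⟨b, hb, -⟩ := hφ.2.2.2 (𝟙 X) hX
  obtain ⟨b', -, hb'u⟩ := hφ.2.2.2 φ hφ.2.2.1
  have h1 : b ≫ φ = b' :=
    hb'u _ (show φ ≫ b ≫ φ = φ by rw [← Category.assoc, hb, Category.id_comp])
  have h2 : 𝟙 Y = b' := hb'u _ (show φ ≫ 𝟙 Y = φ from Category.comp_id φ)
  have hbφ : b ≫ φ = 𝟙 Y := h1.trans h2.symm
  refine ⟨φ ≫ β ≫ b, ⟨?_, ?_⟩, ?_⟩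
  · change Base (pfStr π hF) (φ ≫ β ≫ b) = 𝟙 _
    have hβ₁ : Base (pfStr π hF) β = 𝟙 _ := hβ.1
    rw [base_comp, base_comp, hβ₁, Category.id_comp, ← base_comp, hb, base_id]
  · change degFr (pfStr π hF) (φ ≫ β ≫ b) = 1
    have hβ₂ : degFr (pfStr π hF) β = 1 := hβ.2
    rw [degFr_comp, degFr_comp, hβ₂, one_mul, ← degFr_comp, hb, degFr_id]
  · rw [Category.assoc, Category.assoc, hbφ, Category.comp_id]

/-! ### Theorem 3.6 (i), characteristic-splitting clause, for `C^ℚ := C^pf` -/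

/-- **[FrdII] Thm. 3.6 (i) for `C^ℚ := C^pf`, "the canonical decomposition of Definition 3.1 (ii) determines a
characteristic splitting on `C^Λ`", `Λ = ℚ` — PROVED** over any base `π : D → D₀`, for THE perfection of the
archimedean Frobenioid `C` (L1-t9's generic predicate `ArchFrd.Thm36i_charSplitting`): the family
`τ((A, n)) := lim_→ τ(A^{(c)})` of classes `[θ]` of RADIAL elements `θ ∈ O^▷(A^{(c)})` (base-identity, linear,
positive real scalar — the factor `ord(K^×) ≅ ℝ_{>0}` of Def. 3.1 (ii)) is a characteristic splitting on `C^pf` in the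
sense of [FrdI] Def. 2.3 (`PreFrobenioid.CharacteristicSplitting`: submonoids of `O^▷`, a subfunctor along linear
arrows, `τ → O^▷/O^×` bijective, condition (b) at isotropic hulls), and its submonoids are by construction exactly
the radial classes.  The binder `hF` ("`C` is a Frobenioid", Ex. 3.3 (ii)) is the PARAMETER of the construction
`C^pf = PreFrobenioid.Perfection hF`, i.e. data of the statement.  [cite: MochizukiFrdII2008, Thm 3.6 (i) p.36] -/
theorem charSplitting_Q_holds (hF : PreFrobenioid.IsFrobenioid (C.toElem π)) :
    Literature.AlgebraicGeometry.Frobenioids.ArchFrd.Thm36i_charSplitting (Thm36Sub.pfStr π hF)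
      (fun X t => ∃ (c : ℕ+) (θ : frobPow hF X.obj c ⟶ frobPow hF X.obj c),
        radialO π (frobPow hF X.obj c) θ ∧ PreFrobenioid.Perfection.endClass X c θ = t) := by
  refine ⟨
    { τ := fun X =>
        { carrier := {t | ∃ (c : ℕ+) (θ : frobPow hF X.obj c ⟶ frobPow hF X.obj c),
            radialO π (frobPow hF X.obj c) θ ∧ endClass X c θ = t},
          one_mem' := ⟨1, 𝟙 _, (radialSubmonoid π _).one_mem, endClass_id X 1⟩,
          mul_mem' := fun ht hs => radialClass_comp _ hs ht },
      τ_le := ?_,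
      res_mem := ?_,
      bijective := ?_,
      hull := ?_ }, fun X _ t => Iff.rfl⟩
  · -- `τ((A, n)) ⊆ O^▷((A, n))`
    rintro X - t ⟨c, θ, hθ, rfl⟩
    exact endClass_mem_endSubmonoid X c θ hθ.1
  · -- subfunctor along linear arrows
    rintro X Y - - φ hφ β ⟨c, θβ, hθβ, rfl⟩ α hα h
    obtain ⟨c', θα, hθα, hαe⟩ := exists_endClassHom_eq_of_mem X ((mem_endSubmonoid_pfStr_iff X α).mp hα)
    have hαe' : endClass X c' (End.asHom θα) = α := hαe
    rw [← hαe'] at h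
    obtain ⟨a, b, hab, ψ, θβ', θα', hψ, hθβ', hθα', hcl, hsq⟩ := exists_level_square X φ θβ hθβ _ hθα h
    have hψlin : IsLinear (C.toElem π) ψ := (isLinear_mk_iff ⟨⟨a, b, hab⟩, ψ⟩).mp (by rw [hψ]; exact hφ)
    have hsc := scalar_eq_of_square π ψ hψlin hθβ' hθα' hsq
    exact ⟨a, θα', ⟨hθα', radial_of_scalar_eq π hsc hθβ'.2⟩, hcl.trans hαe'⟩
  · -- Def. 2.3 (a): `τ → O^▷/O^×` bijective
    intro X hX
    constructor
    · rintro ⟨t₁, ht₁⟩ ⟨t₂, ht₂⟩ h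
      obtain ⟨u, hu⟩ := Associates.mk_eq_mk_iff_associated.mp h
      obtain ⟨γ, hγ, hγu⟩ := (PreFrobenioid.isUnit_endSubmonoid_iff (pfStr π hF)
        (u : PreFrobenioid.endSubmonoid (pfStr π hF) X)).mp u.isUnit
      have hprod : (show X ⟶ X from (u : PreFrobenioid.endSubmonoid (pfStr π hF) X).1) ≫
          (show X ⟶ X from t₁) = (show X ⟶ X from t₂) :=
        congrArg (fun e : PreFrobenioid.endSubmonoid (pfStr π hF) X => (show X ⟶ X from e.1)) hu
      exact Subtype.ext (radialClass_eq_of_unit_comp X ht₁ ht₂ γ hγ (hγu ▸ hprod))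
    · rintro ⟨⟨e, he⟩⟩
      obtain ⟨t, ht, γ, hγ, hγt⟩ := exists_unit_comp_radialClass X e he
      obtain ⟨u, hu⟩ := (PreFrobenioid.isUnit_endSubmonoid_iff (pfStr π hF)
        (⟨(γ.hom : End X), hγ⟩ : PreFrobenioid.endSubmonoid (pfStr π hF) X)).mpr ⟨γ, hγ, rfl⟩
      refine ⟨⟨t, ht⟩, ?_⟩
      change Associates.mk _ = Associates.mk (⟨e, he⟩ : PreFrobenioid.endSubmonoid (pfStr π hF) X)
      rw [Associates.mk_eq_mk_iff_associated]
      refine ⟨u, Subtype.ext ?_⟩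
      rw [Submonoid.coe_mul, hu]
      exact hγt
  · -- Def. 2.3 (b)
    rintro X Y φ hφ β ⟨c, θ, hθ, rfl⟩
    exact exists_conj_of_isIsotropicHull X φ hφ _ (endClass_mem_endSubmonoid Y c θ hθ.1)

end Thm36Sub

end ArchFrd

end Literature.AlgebraicGeometry.Frobenioids
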